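import Mathlib
import Literature.Analysis.InnerProduct.WeylEigenvalueInequalities
import Literature.Analysis.InnerProduct.PoincareSeparation
import Summits.ValiantsHypothesis.ValiantsHypothesis.Theorems.LacunarySymmetroidMatrixDescartesLoewnerSector

/-!
# Route «KPlusLogSqLaw», `WeakLifting` (stmt-ValiantsHypothesis-19561), tridiagonal-sector docket — the INTERLACING LAYER over the
# Loewner engine: along NESTED PRINCIPAL BLOCKS of a positively normalisable Loewner-monotone pencil, the determinant zeros interlace

HONEST FRAMING.  Helper file (seat val-sym-lift-p2 g4, cell `pub-symmetroid`, 2026-08-26; desk R1524 (d)(2)(ii) / R1533 (b) / R1543 (a):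
«definite-diagonal half of `stub_tridiagonalSectorBDiag` by Cauchy interlacing along nested principal blocks; the Loewner/normalisation ENGINE
(`LoewnerSector.posRoots_le_of_normalisation`, seat val-sym-mdr-p2) is CITED, this seat types only the interlacing layer»).  Nothing here is about
the sector law `stub_tridiagonalSectorB(Diag)` in its window, `WeakLifting`, `TropicalB`, Conjecture B, the Door-A registers, `MatrixDescartes`
(stmt-ValiantsHypothesis-18050) in general, or VP ≠ VNP.  HONEST READING: the layer lives INSIDE the engine's class (one positive normalisation
makes the pencil Loewner non-decreasing — the «V ≤ 1 world»), where the engine already gives `Z₊ ≤ m`; it does NOT use tridiagonality (nested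
principal blocks of ANY symmetric pencil interlace), so it adds structure (WHERE the zeros of the blocks sit), not a smaller count; outside that
class nothing is claimed — the cell's located remark (lift-p2 g3 README §4) that nested-block TOWERS need INDEFINITE diagonal letters is exactly the
contrapositive use of this file.

WHAT IS PROVED (sorted eigenvalues `λ↓₀ ≥ λ↓₁ ≥ ⋯` = Mathlib's `Matrix.IsHermitian.eigenvalues₀`).
* `eigenvalues₀_mono` — LOEWNER MONOTONICITY of the sorted eigenvalues (`B − A ⪰ 0 ⇒ λ↓_k(A) ≤ λ↓_k(B)`; Weyl, from the Literature's
  `le_eigenvalues₀_add_of_nonneg` [HornJohnson2013, Cor 4.3.3]).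
* `det_eq_prod_eigenvalues₀`, `exists_eigenvalues₀_eq_zero` — bookkeeping (`det = ∏ λ↓_k`).
* `cauchy_codim_one` — Cauchy interlacing for a principal compression of co-dimension one, in `Fin (m+1)` / `Fin m` indexing (from the
  Literature's `cauchy_interlacing_submatrix` [HornJohnson2013, Thm 4.3.28]).
* `zeroIndex_eq` — along a Loewner-non-decreasing symmetric family `G` on `(0,∞)` whose determinant has finitely many positive zeros, if
  `det G` vanishes at `m + 1 = card ι` points `x₀ < ⋯ < x_m`, then AT `x_i` IT IS THE `i`-TH LARGEST EIGENVALUE THAT VANISHES (`λ↓_i(G(x_i)) = 0`):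
  larger eigenvalues cross earlier.
* `det_submatrix_mul_det_submatrix_nonpos` — **THE INTERLACING LAYER (abstract form)**: under the same hypotheses, for every principal compression
  `G′ = G.submatrix f f` of co-dimension one and every `i < m`, `det G′(x_i) · det G′(x_{i+1}) ≤ 0` (at `x_i` the compression has `i` eigenvalues
  `≥ 0` above and `m − i` eigenvalues `≤ 0` below the vanishing one, by Cauchy; at `x_{i+1}` one more is `≥ 0`).
* `subpencil_root_between` — **PENCIL FORM**: for a real symmetric lacunary pencil `F = ∑ₗ X^{dₗ} Sₗ` on `ι` (`card ι = m + 1`) admitting a positive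
  weight `w` with `F/w` Loewner non-decreasing on `(0,∞)` (EXACTLY the engine's hypothesis) and `det F ≠ 0`: if `det F` has `m + 1` positive zeros
  `x₀ < ⋯ < x_m` (the maximum the engine allows), then for every principal sub-pencil `F′ = ∑ₗ X^{dₗ} Sₗ[f,f]` of size `m` and every `i < m`,
  `det F′` has a zero in the closed gap `[x_i, x_{i+1}]` — the zeros of nested principal blocks INTERLACE (intermediate value theorem).
[folklore: Cauchy interlacing + Loewner monotonicity; HornJohnson2013 §4.3 for the two eigenvalue inequalities, cited through the Literature files]
-/

set_option linter.dupNamespace false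
set_option autoImplicit false

namespace Summit.ValiantsHypothesis.ValiantsHypothesis.Theorems.KPlusLogSqLaw

open Matrix Finset Polynomial
open scoped BigOperators

namespace LoewnerInterlacing

variable {ι : Type} [Fintype ι] [DecidableEq ι]

/-! ## 1. Sorted eigenvalues: Loewner monotonicity, determinant, Cauchy in co-dimension one -/

/-- **Loewner monotonicity of the sorted eigenvalues** (Weyl): if `B − A ⪰ 0` then `λ↓_k(A) ≤ λ↓_k(B)` for every `k`.
[cite: HornJohnson2013, Cor 4.3.3; via `Literature.Analysis.InnerProduct.le_eigenvalues₀_add_of_nonneg`] -/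
theorem eigenvalues₀_mono {A B : Matrix ι ι ℝ} (hA : A.IsHermitian) (hB : B.IsHermitian) (hAB : (B - A).PosSemidef)
    (k : Fin (Fintype.card ι)) : hA.eigenvalues₀ k ≤ hB.eigenvalues₀ k := by
  have hcard : 0 < Fintype.card ι := Fin.pos k
  let q : Fin (Fintype.card ι) := ⟨Fintype.card ι - 1, by omega⟩
  have hq : 0 ≤ hAB.1.eigenvalues₀ q := by
    have h := hAB.eigenvalues_nonneg ((Fintype.equivOfCardEq (Fintype.card_fin _)) q)
    simpa [Matrix.IsHermitian.eigenvalues] using h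
  exact Literature.Analysis.InnerProduct.le_eigenvalues₀_add_of_nonneg hA hAB.1 (by abel) hB q hq k k
    (by simp only [q]; omega)

/-- the determinant of a real symmetric matrix is the product of its sorted eigenvalues. [folklore] -/
theorem det_eq_prod_eigenvalues₀ {A : Matrix ι ι ℝ} (hA : A.IsHermitian) : A.det = ∏ k, hA.eigenvalues₀ k := by
  rw [hA.det_eq_prod_eigenvalues]
  simp only [RCLike.ofReal_real_eq_id, id_eq]
  exact Fintype.prod_equiv (Fintype.equivOfCardEq (Fintype.card_fin _)).symm _ _ (fun i => rfl)

/-- a singular real symmetric matrix has a vanishing sorted eigenvalue. [folklore] -/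
theorem exists_eigenvalues₀_eq_zero {A : Matrix ι ι ℝ} (hA : A.IsHermitian) (h : A.det = 0) :
    ∃ k, hA.eigenvalues₀ k = 0 := by
  rw [det_eq_prod_eigenvalues₀ hA, Finset.prod_eq_zero_iff] at h
  obtain ⟨k, -, hk⟩ := h
  exact ⟨k, hk⟩

/-- **Cauchy interlacing in co-dimension one**, `Fin (m+1)` / `Fin m` indexing: for a principal compression `A[f,f]` (`f` injective,
`card ι = m + 1`, `card ι' = m`) and `j < m`, `λ↓_{j+1}(A) ≤ λ↓_j(A[f,f]) ≤ λ↓_j(A)`.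
[cite: HornJohnson2013, Thm 4.3.28; via `Literature.Analysis.InnerProduct.cauchy_interlacing_submatrix`] -/
theorem cauchy_codim_one {ι' : Type} [Fintype ι'] [DecidableEq ι'] {m : ℕ} (hι : Fintype.card ι = m + 1)
    (hι' : Fintype.card ι' = m) {A : Matrix ι ι ℝ} (hA : A.IsHermitian) (f : ι' → ι) (hf : Function.Injective f)
    (j : Fin m) :
    hA.eigenvalues₀ (Fin.cast hι.symm j.succ) ≤ (hA.submatrix f).eigenvalues₀ (Fin.cast hι'.symm j) ∧
      (hA.submatrix f).eigenvalues₀ (Fin.cast hι'.symm j) ≤ hA.eigenvalues₀ (Fin.cast hι.symm j.castSucc) := by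
  obtain ⟨h1, h2⟩ := Literature.Analysis.InnerProduct.cauchy_interlacing_submatrix hA f hf (hA.submatrix f)
    (Fin.cast hι'.symm j)
  constructor
  · convert h1 using 2
    exact Fin.ext (by simp [hι, hι'])
  · convert h2 using 2
    exact Fin.ext (by simp)

/-- sign bookkeeping: if `μ` is `≥ 0` before position `k` and `≤ 0` from `k` on, while `ν` is `≥ 0` up to `k` and `≤ 0` after `k`, then
`(∏ μ) · (∏ ν) ≤ 0` (the `k`-th factors have opposite signs, all other paired factors equal signs). [folklore] -/
theorem prod_mul_prod_nonpos {m : ℕ} (μ ν : Fin m → ℝ) (k : Fin m)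
    (hμ₁ : ∀ j, j < k → 0 ≤ μ j) (hμ₂ : ∀ j, k ≤ j → μ j ≤ 0)
    (hν₁ : ∀ j, j ≤ k → 0 ≤ ν j) (hν₂ : ∀ j, k < j → ν j ≤ 0) :
    (∏ j, μ j) * (∏ j, ν j) ≤ 0 := by
  rw [← Finset.prod_mul_distrib, ← Finset.mul_prod_erase univ (fun j => μ j * ν j) (mem_univ k)]
  have hk : μ k * ν k ≤ 0 := mul_nonpos_iff.mpr (Or.inr ⟨hμ₂ k le_rfl, hν₁ k le_rfl⟩)
  have hrest : 0 ≤ ∏ j ∈ univ.erase k, μ j * ν j := by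
    refine Finset.prod_nonneg fun j hj => ?_
    have hjk : j ≠ k := ne_of_mem_erase hj
    rcases lt_or_gt_of_ne hjk with h | h
    · exact mul_nonneg (hμ₁ j h) (hν₁ j h.le)
    · exact mul_nonneg_of_nonpos_of_nonpos (hμ₂ j h.le) (hν₂ j h)
  exact mul_nonpos_iff.mpr (Or.inr ⟨hk, hrest⟩)

/-! ## 2. The zero index along a Loewner-monotone family -/

/-- **At the `i`-th zero it is the `i`-th largest eigenvalue that vanishes.**  Let `G : ℝ → Matrix ι ι ℝ` be real symmetric and Loewner
non-decreasing on `(0,∞)`, with finitely many positive determinant zeros, `card ι = m + 1`, and let `det G` vanish at `x₀ < ⋯ < x_m` (positive).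
Then `λ↓_i(G(x_i)) = 0` for every `i`.  (If a larger-or-equal-indexed eigenvalue vanished at an earlier zero it would vanish identically in
between, by monotonicity in `x` and in the index.) [folklore] -/
theorem zeroIndex_eq {m : ℕ} (hι : Fintype.card ι = m + 1) (G : ℝ → Matrix ι ι ℝ) (hG : ∀ s, (G s).IsHermitian)
    (hmono : ∀ s t : ℝ, 0 < s → s ≤ t → (G t - G s).PosSemidef)
    (hfin : Set.Finite {s : ℝ | 0 < s ∧ (G s).det = 0})
    (x : Fin (m + 1) → ℝ) (hx : StrictMono x) (hxpos : ∀ i, 0 < x i) (hroot : ∀ i, (G (x i)).det = 0) :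
    ∀ i, (hG (x i)).eigenvalues₀ (Fin.cast hι.symm i) = 0 := by
  -- monotonicity in `s` and antitonicity in the index
  have hmn : ∀ s t : ℝ, 0 < s → s ≤ t → ∀ k, (hG s).eigenvalues₀ k ≤ (hG t).eigenvalues₀ k :=
    fun s t hs hst k => eigenvalues₀_mono (hG s) (hG t) (hmono s t hs hst) k
  have hanti : ∀ s (k k' : Fin (Fintype.card ι)), k ≤ k' → (hG s).eigenvalues₀ k' ≤ (hG s).eigenvalues₀ k :=
    fun s k k' h => (hG s).eigenvalues₀_antitone h
  -- choose a vanishing index at each zero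
  have hex : ∀ i, ∃ k : Fin (m + 1), (hG (x i)).eigenvalues₀ (Fin.cast hι.symm k) = 0 := by
    intro i
    obtain ⟨k, hk⟩ := exists_eigenvalues₀_eq_zero (hG (x i)) (hroot i)
    exact ⟨Fin.cast hι k, by simpa using hk⟩
  choose kf hkf using hex
  -- `kf` is strictly increasing
  have hsm : StrictMono kf := by
    intro i j hij
    by_contra hle
    rw [not_lt] at hle
    -- the `kf i`-th eigenvalue vanishes at `x j` as well
    have h0j : (hG (x j)).eigenvalues₀ (Fin.cast hι.symm (kf i)) = 0 := by
      apply le_antisymm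
      · calc (hG (x j)).eigenvalues₀ (Fin.cast hι.symm (kf i))
            ≤ (hG (x j)).eigenvalues₀ (Fin.cast hι.symm (kf j)) := hanti _ _ _ hle
          _ = 0 := hkf j
      · calc (0 : ℝ) = (hG (x i)).eigenvalues₀ (Fin.cast hι.symm (kf i)) := (hkf i).symm
          _ ≤ (hG (x j)).eigenvalues₀ (Fin.cast hι.symm (kf i)) := hmn _ _ (hxpos i) (hx hij).le _
    -- hence it vanishes on the whole interval `[x i, x j]`, an infinite set of determinant zeros
    have hzero : ∀ s, x i ≤ s → s ≤ x j → (G s).det = 0 := by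
      intro s h1 h2
      have hs : 0 < s := lt_of_lt_of_le (hxpos i) h1
      have hev : (hG s).eigenvalues₀ (Fin.cast hι.symm (kf i)) = 0 := by
        apply le_antisymm
        · calc (hG s).eigenvalues₀ (Fin.cast hι.symm (kf i))
              ≤ (hG (x j)).eigenvalues₀ (Fin.cast hι.symm (kf i)) := hmn _ _ hs h2 _
            _ = 0 := h0j
        · calc (0 : ℝ) = (hG (x i)).eigenvalues₀ (Fin.cast hι.symm (kf i)) := (hkf i).symm
            _ ≤ (hG s).eigenvalues₀ (Fin.cast hι.symm (kf i)) := hmn _ _ (hxpos i) h1 _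
      rw [det_eq_prod_eigenvalues₀ (hG s)]
      exact Finset.prod_eq_zero (mem_univ _) hev
    have hsub : Set.Icc (x i) (x j) ⊆ {s : ℝ | 0 < s ∧ (G s).det = 0} := fun s hs =>
      ⟨lt_of_lt_of_le (hxpos i) hs.1, hzero s hs.1 hs.2⟩
    exact (Set.Icc_infinite (hx hij)) (hfin.subset hsub)
  -- a strictly increasing self-map of `Fin (m+1)` is the identity
  have hid : kf = id := by
    have h1 := Finset.orderEmbOfFin_unique (s := (univ : Finset (Fin (m + 1)))) (by simp) (f := kf)
      (fun _ => mem_univ _) hsm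
    have h2 := Finset.orderEmbOfFin_unique (s := (univ : Finset (Fin (m + 1)))) (by simp) (f := id)
      (fun _ => mem_univ _) strictMono_id
    rw [h1, ← h2]
  intro i
  have := hkf i
  rwa [hid] at this

/-! ## 3. The interlacing layer, abstract form -/

/-- **INTERLACING LAYER (abstract form).**  Let `G : ℝ → Matrix ι ι ℝ` be real symmetric and Loewner non-decreasing on `(0,∞)` with
finitely many positive determinant zeros, `card ι = m + 1`, and let `det G` vanish at `x₀ < ⋯ < x_m` (positive).  Then for every principal
compression `G′ = G[f,f]` of co-dimension one (`f : ι' → ι` injective, `card ι' = m`) and every `i < m`,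
`det G′(x_i) · det G′(x_{i+1}) ≤ 0`. [folklore: Cauchy interlacing + Loewner monotonicity] -/
theorem det_submatrix_mul_det_submatrix_nonpos {ι' : Type} [Fintype ι'] [DecidableEq ι'] {m : ℕ}
    (hι : Fintype.card ι = m + 1) (hι' : Fintype.card ι' = m) (f : ι' → ι) (hf : Function.Injective f)
    (G : ℝ → Matrix ι ι ℝ) (hG : ∀ s, (G s).IsHermitian)
    (hmono : ∀ s t : ℝ, 0 < s → s ≤ t → (G t - G s).PosSemidef)
    (hfin : Set.Finite {s : ℝ | 0 < s ∧ (G s).det = 0})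
    (x : Fin (m + 1) → ℝ) (hx : StrictMono x) (hxpos : ∀ i, 0 < x i) (hroot : ∀ i, (G (x i)).det = 0) (i : Fin m) :
    ((G (x i.castSucc)).submatrix f f).det * ((G (x i.succ)).submatrix f f).det ≤ 0 := by
  have hk := zeroIndex_eq hι G hG hmono hfin x hx hxpos hroot
  have hanti : ∀ s (k k' : Fin (m + 1)), k ≤ k' →
      (hG s).eigenvalues₀ (Fin.cast hι.symm k') ≤ (hG s).eigenvalues₀ (Fin.cast hι.symm k) :=
    fun s k k' h => (hG s).eigenvalues₀_antitone (show (Fin.cast hι.symm k : ℕ) ≤ Fin.cast hι.symm k' by simpa using h)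
  -- eigenvalues of the compression at the two zeros
  let μ : ℝ → Fin m → ℝ := fun s j => ((hG s).submatrix f).eigenvalues₀ (Fin.cast hι'.symm j)
  have hdet : ∀ s, ((G s).submatrix f f).det = ∏ j, μ s j := by
    intro s
    rw [det_eq_prod_eigenvalues₀ ((hG s).submatrix f)]
    exact Fintype.prod_equiv (finCongr hι') _ _ (fun k => by simp [μ])
  have hc : ∀ s (j : Fin m), (hG s).eigenvalues₀ (Fin.cast hι.symm j.succ) ≤ μ s j ∧
      μ s j ≤ (hG s).eigenvalues₀ (Fin.cast hι.symm j.castSucc) :=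
    fun s j => cauchy_codim_one hι hι' (hG s) f hf j
  rw [hdet, hdet]
  refine prod_mul_prod_nonpos (μ (x i.castSucc)) (μ (x i.succ)) i ?_ ?_ ?_ ?_
  · -- at `x_i`, indices `j < i` of the compression are `≥ 0`
    intro j hj
    calc (0 : ℝ) = (hG (x i.castSucc)).eigenvalues₀ (Fin.cast hι.symm i.castSucc) := (hk i.castSucc).symm
      _ ≤ (hG (x i.castSucc)).eigenvalues₀ (Fin.cast hι.symm j.succ) :=
          hanti _ _ _ (by rw [Fin.le_iff_val_le_val]; simp; omega)
      _ ≤ μ (x i.castSucc) j := (hc _ j).1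
  · -- at `x_i`, indices `j ≥ i` are `≤ 0`
    intro j hj
    calc μ (x i.castSucc) j ≤ (hG (x i.castSucc)).eigenvalues₀ (Fin.cast hι.symm j.castSucc) := (hc _ j).2
      _ ≤ (hG (x i.castSucc)).eigenvalues₀ (Fin.cast hι.symm i.castSucc) :=
          hanti _ _ _ (by rw [Fin.le_iff_val_le_val]; simp; omega)
      _ = 0 := hk i.castSucc
  · -- at `x_{i+1}`, indices `j ≤ i` are `≥ 0`
    intro j hj
    calc (0 : ℝ) = (hG (x i.succ)).eigenvalues₀ (Fin.cast hι.symm i.succ) := (hk i.succ).symm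
      _ ≤ (hG (x i.succ)).eigenvalues₀ (Fin.cast hι.symm j.succ) :=
          hanti _ _ _ (by rw [Fin.le_iff_val_le_val]; simp; omega)
      _ ≤ μ (x i.succ) j := (hc _ j).1
  · -- at `x_{i+1}`, indices `j > i` are `≤ 0`
    intro j hj
    calc μ (x i.succ) j ≤ (hG (x i.succ)).eigenvalues₀ (Fin.cast hι.symm j.castSucc) := (hc _ j).2
      _ ≤ (hG (x i.succ)).eigenvalues₀ (Fin.cast hι.symm i.succ) :=
          hanti _ _ _ (by rw [Fin.le_iff_val_le_val]; simp; omega)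
      _ = 0 := hk i.succ

/-! ## 4. Pencil form: zeros of nested principal blocks of a normalisable Loewner-monotone lacunary pencil interlace -/

omit [Fintype ι] [DecidableEq ι] in
/-- principal compressions commute with evaluating the pencil. -/
theorem submatrix_family {ι' : Type} {K : ℕ} (f : ι' → ι) (d : Fin K → ℕ) (S : Fin K → Matrix ι ι ℝ) (c u : ℝ) :
    (c • ∑ l, (u ^ d l) • S l).submatrix f f = c • ∑ l, (u ^ d l) • (S l).submatrix f f := by
  ext i j
  simp [Matrix.submatrix_apply, Matrix.sum_apply, Matrix.smul_apply]

/-- **INTERLACING OF NESTED PRINCIPAL BLOCKS (pencil form).**  Let `F = ∑ₗ X^{dₗ} Sₗ` be a real symmetric lacunary pencil on `ι`,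
`card ι = m + 1`, admitting a positive weight `w` on `(0,∞)` with `u ↦ w(u)⁻¹ F(u)` Loewner non-decreasing (the hypothesis of the engine
`LoewnerSector.posRoots_le_of_normalisation`, which gives `Z₊(det F) ≤ m + 1`), with `det F ≠ 0`.  If `det F` has `m + 1` positive zeros
`x₀ < ⋯ < x_m`, then for every principal sub-pencil `F′ = ∑ₗ X^{dₗ} Sₗ[f,f]` of size `m` (`f` injective) and every `i < m`, `det F′` has a zero
in the closed gap `[x_i, x_{i+1}]`. [folklore: Cauchy interlacing + Loewner monotonicity + intermediate value theorem] -/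
theorem subpencil_root_between {ι' : Type} [Fintype ι'] [DecidableEq ι'] {m K : ℕ}
    (hι : Fintype.card ι = m + 1) (hι' : Fintype.card ι' = m) (f : ι' → ι) (hf : Function.Injective f)
    (d : Fin K → ℕ) (S : Fin K → Matrix ι ι ℝ) (hS : ∀ l, (S l).IsSymm) (w : ℝ → ℝ) (hw : ∀ u, 0 < u → 0 < w u)
    (hmono : ∀ s t : ℝ, 0 < s → s ≤ t →
      (((w t)⁻¹ • ∑ l, (t ^ d l) • S l) - ((w s)⁻¹ • ∑ l, (s ^ d l) • S l)).PosSemidef)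
    (hP : (Matrix.det (∑ l, ((X : ℝ[X]) ^ d l) • (S l).map C)) ≠ 0)
    (x : Fin (m + 1) → ℝ) (hx : StrictMono x) (hxpos : ∀ i, 0 < x i)
    (hroot : ∀ i, (Matrix.det (∑ l, ((X : ℝ[X]) ^ d l) • (S l).map C)).IsRoot (x i)) (i : Fin m) :
    ∃ y, x i.castSucc ≤ y ∧ y ≤ x i.succ ∧
      (Matrix.det (∑ l, ((X : ℝ[X]) ^ d l) • ((S l).submatrix f f).map C)).IsRoot y := by
  set P := Matrix.det (∑ l, ((X : ℝ[X]) ^ d l) • (S l).map C) with hPdef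
  set P' := Matrix.det (∑ l, ((X : ℝ[X]) ^ d l) • ((S l).submatrix f f).map C) with hP'def
  let G : ℝ → Matrix ι ι ℝ := fun u => (w u)⁻¹ • ∑ l, (u ^ d l) • S l
  have hG : ∀ s, (G s).IsHermitian := fun s =>
    Matrix.isHermitian_iff_isSymm.mpr (LacunarySymmetroidMatrixDescartes.LoewnerSector.smul_family_isSymm d S hS _ s)
  -- determinants of the family and of its compression, in terms of the pencil polynomials
  have hdetG : ∀ s, (G s).det = (w s)⁻¹ ^ Fintype.card ι * P.eval s := by
    intro s
    simp only [G, Matrix.det_smul, hPdef]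
    rw [LacunarySymmetroidMatrixDescartes.ChainSector.eval_det_pencil]
  have hdetG' : ∀ s, ((G s).submatrix f f).det = (w s)⁻¹ ^ Fintype.card ι' * P'.eval s := by
    intro s
    simp only [G, hP'def]
    rw [submatrix_family, Matrix.det_smul, LacunarySymmetroidMatrixDescartes.ChainSector.eval_det_pencil]
  -- hypotheses of the abstract layer
  have hfin : Set.Finite {s : ℝ | 0 < s ∧ (G s).det = 0} := by
    refine (Polynomial.finite_setOf_isRoot hP).subset ?_
    intro s hs
    obtain ⟨hs0, hs⟩ := hs
    rw [hdetG] at hs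
    have hws : (w s)⁻¹ ^ Fintype.card ι ≠ 0 := pow_ne_zero _ (inv_ne_zero (hw s hs0).ne')
    exact (mul_eq_zero.mp hs).resolve_left hws
  have hrootG : ∀ i, (G (x i)).det = 0 := by
    intro i
    rw [hdetG, (hroot i).eq_zero, mul_zero]
  have hlay := det_submatrix_mul_det_submatrix_nonpos hι hι' f hf G hG
    (fun s t hs hst => hmono s t hs hst) hfin x hx hxpos hrootG i
  rw [hdetG', hdetG'] at hlay
  -- strip the positive factors
  have ha : 0 < (w (x i.castSucc))⁻¹ ^ Fintype.card ι' := pow_pos (inv_pos.mpr (hw _ (hxpos _))) _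
  have hb : 0 < (w (x i.succ))⁻¹ ^ Fintype.card ι' := pow_pos (inv_pos.mpr (hw _ (hxpos _))) _
  have hprod : P'.eval (x i.castSucc) * P'.eval (x i.succ) ≤ 0 := by
    have : (w (x i.castSucc))⁻¹ ^ Fintype.card ι' * P'.eval (x i.castSucc) *
        ((w (x i.succ))⁻¹ ^ Fintype.card ι' * P'.eval (x i.succ)) =
        ((w (x i.castSucc))⁻¹ ^ Fintype.card ι' * (w (x i.succ))⁻¹ ^ Fintype.card ι') *
          (P'.eval (x i.castSucc) * P'.eval (x i.succ)) := by ring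
    rw [this] at hlay
    by_contra hcon
    rw [not_le] at hcon
    have := mul_pos (mul_pos ha hb) hcon
    linarith
  -- intermediate value theorem on the closed gap
  have hle : x i.castSucc ≤ x i.succ := (hx Fin.castSucc_lt_succ).le
  have hcont : ContinuousOn (fun u => P'.eval u) (Set.Icc (x i.castSucc) (x i.succ)) :=
    P'.continuous.continuousOn
  rcases mul_nonpos_iff.mp hprod with ⟨h1, h2⟩ | ⟨h1, h2⟩
  · -- `P'(x_i) ≥ 0 ≥ P'(x_{i+1})`
    obtain ⟨y, hy, hy0⟩ := intermediate_value_Icc' hle hcont ⟨h2, h1⟩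
    exact ⟨y, hy.1, hy.2, hy0⟩
  · -- `P'(x_i) ≤ 0 ≤ P'(x_{i+1})`
    obtain ⟨y, hy, hy0⟩ := intermediate_value_Icc hle hcont ⟨h1, h2⟩
    exact ⟨y, hy.1, hy.2, hy0⟩

end LoewnerInterlacing

end Summit.ValiantsHypothesis.ValiantsHypothesis.Theorems.KPlusLogSqLaw
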